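import Summits.QuantumFields.YangMills.Theorems.ToronSmallBallSiteTwistDefs
import Summits.QuantumFields.YangMills.Theorems.ToronSmallBallSheetTranslateAction
import Summits.QuantumFields.YangMills.Theorems.ToronSmallBallSheetTranslateCore
import HarnessLib

/-!
# The site-dependent sheet translate `siteTwist k h`: gauge covariance, measure preservation, time-coupling invariance, plane defects, holonomies

Support module for the covariant-translate cruxes of seat ym-idea-4's LINE g12-A/B (`ToronSmallBall.ToronCoreRaritySubQuartic` ⟨stmt-QuantumFields-23956⟩,
`OffCoreStripWindowDeep` ⟨23957⟩, `QuantileBitPurity.HolonomyQuantileSubQuartic` ⟨23948⟩, `HolonomyLevyWindowDeep` ⟨23949⟩; memo HOME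
`bc/g12-A/PLAN-X1-v2-gauss.md` §1–§2).  For `siteTwist k h U` (Defs module `ToronSmallBallSiteTwistDefs`: multiply the `k`-link issuing from each plane
site `x`, `x_k = 0`, by `h x`) we prove the exact identities the memo's case tree uses:

* §1 ★ `gaugeTransform_siteTwist` — GAUGE COVARIANCE `(siteTwist_k^h U)^g = siteTwist k (x ↦ g(x) h(x) g(x)⁻¹) (U^g)`; in particular the gauge image of the
  constant sheet translate is site-dependent, `(twist_k^h U)^g = siteTwist k (x ↦ g(x) h g(x)⁻¹) (U^g)` (`gaugeTransform_twist`) — the seam identity of the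
  memo's §1 ERRATUM; composition `siteTwist_mul` and inverse `siteTwist_inv_siteTwist`;
* §2 `measurePreserving_siteTwist` (configuration-independent `h`: link by link a left translation) and ★ `timeCoupling_siteTwist_siteTwist` — the time-like
  coupling is EXACTLY invariant when both slices are translated by the SAME `h` (trace cyclicity, link by link);
* §3 plaquettes: unchanged off the plane / in planes not containing `k`; on the plane the conjugation formulas with the TRANSPORT MISMATCH
  `h(x)` vs `h(x + e_j)` (`plaquetteHolonomy_siteTwist_fst/_snd`, `trace_plaquetteHolonomy_siteTwist_snd`); the action decomposition
  `wilsonAction_siteTwist_sub` and the defect bound `|Δ_p| ≤ √N ‖ρ(U(x,i)) ρ(h(x+e_i)) − ρ(h x) ρ(U(x,i))‖_F` (`abs_re_trace_plaquette_siteTwist_snd_sub_le`):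
  «defects = failure of `h` to be covariantly transported along plane links» (PLAN-X1 v2 §2 (α)/(β));
* §4 (`SU(2)`) holonomies through the origin: `polyX (siteTwist 0 h U) = h 0 · polyX U` (only the origin's link of the `x`-axis lies on the plane) and the
  `y`-, `z`-holonomies are untouched (`configPerm_siteTwist`, `polDist_configPerm_swap_siteTwist_zero`).

HONEST FRAMING: exact fixed-lattice identities and one Cauchy–Schwarz trace inequality; no estimate on any measure, no semiclassics; nothing about infinite
volume, the continuum limit or the Clay gap.  No `sorry`, no new axiom, no new definition.
References: [cite: tHooft1979]; [cite: Luscher1983, §2]; [cite: SeilerLNP1982, §3]; [cite: Wilson1974].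
-/

set_option autoImplicit false

noncomputable section

open MeasureTheory Filter Topology
open Literature.MathematicalPhysics.QuantumFieldTheory
open Literature.MathematicalPhysics.QuantumLattice
open scoped BigOperators

namespace Summit.QuantumFields.YangMills.Theorems.FemtoTransferGap

/-! ## §1 Gauge covariance, composition -/

section Algebra

variable {G : Type*} [Group G] {L : ℕ}

/-- `siteTwist` evaluated. [folklore] -/
theorem siteTwist_apply (k : Fin 3) (h : Site 3 L → G) (U : GaugeConfig 3 L G) (e : Edge 3 L) :
    siteTwist k h U e = if e.2 = k ∧ e.1 k = 0 then h e.1 * U e else U e := rfl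

/-- ★ **Gauge covariance of the site-dependent sheet translate**: `(siteTwist_k^h U)^g = siteTwist k (x ↦ g(x) h(x) g(x)⁻¹) (U^g)` — a gauge transformation
conjugates the translate element at each plane site. [cite: tHooft1979] [cite: SeilerLNP1982, §3] -/
theorem gaugeTransform_siteTwist (g : Site 3 L → G) (k : Fin 3) (h : Site 3 L → G) (U : GaugeConfig 3 L G) :
    gaugeTransform g (siteTwist k h U) = siteTwist k (fun x => g x * h x * (g x)⁻¹) (gaugeTransform g U) := by
  funext e
  simp only [gaugeTransform, siteTwist]
  split_ifs
  · simp only [mul_assoc, inv_mul_cancel_left]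
  · rfl

/-- The gauge image of the CONSTANT sheet translate is the site-dependent translate by the conjugates `g(x) h g(x)⁻¹` (the seam identity behind the
erratum of PLAN-X1 v2 §1: `(twist_h U)^g ≠ twist_h (U^g)` unless `h` commutes with `g` on the plane). [cite: tHooft1979] -/
theorem gaugeTransform_twist (g : Site 3 L → G) (k : Fin 3) (h : G) (U : GaugeConfig 3 L G) :
    gaugeTransform g (twist k h U) = siteTwist k (fun x => g x * h * (g x)⁻¹) (gaugeTransform g U) := by
  rw [← siteTwist_const, gaugeTransform_siteTwist]

/-- If the translate elements commute with the gauge transformation on the plane, the two operations commute. [folklore] -/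
theorem gaugeTransform_siteTwist_of_commute (g : Site 3 L → G) (k : Fin 3) (h : Site 3 L → G) (U : GaugeConfig 3 L G)
    (hc : ∀ x : Site 3 L, x k = 0 → g x * h x = h x * g x) :
    gaugeTransform g (siteTwist k h U) = siteTwist k h (gaugeTransform g U) := by
  rw [gaugeTransform_siteTwist]
  funext e
  simp only [siteTwist]
  split_ifs with he
  · rw [hc e.1 he.2, mul_inv_cancel_right]
  · rfl

/-- Composition: `siteTwist k h (siteTwist k h' U) = siteTwist k (h · h') U`. [folklore] -/
theorem siteTwist_mul (k : Fin 3) (h h' : Site 3 L → G) (U : GaugeConfig 3 L G) :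
    siteTwist k h (siteTwist k h' U) = siteTwist k (fun x => h x * h' x) U := by
  funext e
  simp only [siteTwist]
  split_ifs
  · rw [mul_assoc]
  · rfl

/-- Inverse: `siteTwist k h⁻¹ (siteTwist k h U) = U`. [folklore] -/
theorem siteTwist_inv_siteTwist (k : Fin 3) (h : Site 3 L → G) (U : GaugeConfig 3 L G) :
    siteTwist k (fun x => (h x)⁻¹) (siteTwist k h U) = U := by
  rw [siteTwist_mul]
  funext e
  simp only [siteTwist, inv_mul_cancel, one_mul, ite_self]

end Algebra

/-! ## §2 Measure preservation and the time-like coupling -/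

section Kernel

variable {N : ℕ} {G : Type*} [Group G] (ρ : G →* Matrix (Fin N) (Fin N) ℂ) {L : ℕ}

/-- ★ **The time-like coupling is invariant under a simultaneous site-dependent sheet translate of both slices by the SAME `h`**:
`Σₑ Re tr ρ((h_x Uₑ)(h_x Vₑ)⁻¹) = Σₑ Re tr ρ(UₑVₑ⁻¹)` (trace cyclicity, link by link). [cite: tHooft1979] [cite: SeilerLNP1982, §3] -/
theorem timeCoupling_siteTwist_siteTwist [NeZero L] (k : Fin 3) (h : Site 3 L → G) (U V : GaugeConfig 3 L G) :
    timeCoupling ρ (siteTwist k h U) (siteTwist k h V) = timeCoupling ρ U V := by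
  have htr : ∀ (a b : G), (ρ (a * b * a⁻¹)).trace = (ρ b).trace := fun a b => by
    rw [map_mul, map_mul, Matrix.trace_mul_cycle, ← map_mul, inv_mul_cancel, map_one, one_mul]
  unfold timeCoupling
  refine Finset.sum_congr rfl fun e _ => ?_
  have hU : siteTwist k h U e * (siteTwist k h V e)⁻¹ =
      if e.2 = k ∧ e.1 k = 0 then h e.1 * (U e * (V e)⁻¹) * (h e.1)⁻¹ else U e * (V e)⁻¹ := by
    simp only [siteTwist]
    split_ifs
    · rw [mul_inv_rev]; simp only [mul_assoc]
    · rfl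
  rw [hU]
  split_ifs
  · rw [htr]
  · rfl

/-- The transfer kernel under a simultaneous site-dependent sheet translate: only the two Wilson actions change. [cite: SeilerLNP1982, §3] -/
theorem transferKernel_siteTwist_siteTwist [NeZero L] (β : ℝ) (k : Fin 3) (h : Site 3 L → G) (U V : GaugeConfig 3 L G) :
    transferKernel ρ β (siteTwist k h U) (siteTwist k h V) =
      transferKernel ρ β U V * Real.exp (-(β / 2) * ((wilsonAction ρ (siteTwist k h U) - wilsonAction ρ U) +
        (wilsonAction ρ (siteTwist k h V) - wilsonAction ρ V))) := by
  unfold transferKernel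
  rw [timeCoupling_siteTwist_siteTwist, ← Real.exp_add]
  congr 1
  ring

variable [MeasurableSpace G] [TopologicalSpace G] [IsTopologicalGroup G] [BorelSpace G] [CompactSpace G]

omit ρ in
/-- **Site-dependent sheet translates preserve the a-priori measure** (configuration-independent `h`: link by link a left translation or the identity).
[folklore] -/
theorem measurePreserving_siteTwist [NeZero L] (k : Fin 3) (h : Site 3 L → G) :
    MeasurePreserving (siteTwist k h : GaugeConfig 3 L G → GaugeConfig 3 L G) (configMeasure G L) (configMeasure G L) := by
  refine measurePreserving_pi (f := fun (e : Edge 3 L) (x : G) => if e.2 = k ∧ e.1 k = 0 then h e.1 * x else x)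
    (fun _ : Edge 3 L => haarProbability G) (fun _ : Edge 3 L => haarProbability G) fun e => ?_
  by_cases he : e.2 = k ∧ e.1 k = 0
  · simp only [he, and_self, if_true]
    exact measurePreserving_mul_left (haarProbability G) (h e.1)
  · simp only [he, if_false]
    exact MeasurePreserving.id _

omit ρ in
/-- Slice-wise site-dependent translates of a chain (slice- and site-dependent, configuration-independent elements) preserve the product measure. [folklore] -/
theorem measurePreserving_siteTwist_slices [NeZero L] {n : ℕ} (k : Fin 3) (h : Fin n → Site 3 L → G) :
    MeasurePreserving (fun (Us : Fin n → GaugeConfig 3 L G) (t : Fin n) => siteTwist k (h t) (Us t))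
      (Measure.pi fun _ : Fin n => configMeasure G L) (Measure.pi fun _ : Fin n => configMeasure G L) :=
  measurePreserving_pi (fun _ : Fin n => configMeasure G L) (fun _ : Fin n => configMeasure G L) fun t => measurePreserving_siteTwist k (h t)

end Kernel

/-! ## §3 Plaquettes: the transport mismatch on the plane -/

section Plaquette

variable {N : ℕ} {G : Type*} [Group G] (ρ : G →* Matrix (Fin N) (Fin N) ℂ) {L : ℕ}

omit ρ in
/-- Off the plane `x_k = 0` nothing changes. [folklore] -/
theorem plaquetteHolonomy_siteTwist_of_apply_ne_zero (k : Fin 3) (h : Site 3 L → G) (U : GaugeConfig 3 L G) (x : Site 3 L) {i j : Fin 3}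
    (hij : i ≠ j) (hx : x k ≠ 0) : plaquetteHolonomy (siteTwist k h U) x i j = plaquetteHolonomy U x i j := by
  have hsh : ∀ (y : Site 3 L) {a b : Fin 3}, b ≠ a → (y.shift a) b = y b := fun y a b hab => by
    simp [Site.shift, Pi.single_eq_of_ne hab]
  have hji : j ≠ i := hij.symm
  unfold plaquetteHolonomy
  by_cases hki : i = k
  · subst hki
    have h3 : (x.shift j) i ≠ 0 := by rw [hsh x hij]; exact hx
    simp only [siteTwist, hx, h3, hji, and_false, false_and, if_false]
  · by_cases hkj : j = k
    · subst hkj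
      have h2 : (x.shift i) j ≠ 0 := by rw [hsh x hji]; exact hx
      simp only [siteTwist, hx, h2, hki, and_false, false_and, if_false]
    · simp only [siteTwist, hki, hkj, false_and, if_false]

omit ρ in
/-- In a plane not containing the direction `k` nothing changes. [folklore] -/
theorem plaquetteHolonomy_siteTwist_of_ne_of_ne (k : Fin 3) (h : Site 3 L → G) (U : GaugeConfig 3 L G) (x : Site 3 L) {i j : Fin 3} (hik : i ≠ k)
    (hjk : j ≠ k) : plaquetteHolonomy (siteTwist k h U) x i j = plaquetteHolonomy U x i j := by
  unfold plaquetteHolonomy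
  simp only [siteTwist, hik, hjk, false_and, if_false]

omit ρ in
/-- **First direction on the plane** (`k ≠ j`, `x_k = 0`): `(siteTwist_k^h U)_{x;k,j} = h(x) · U(x,k) U(x+e_k,j) U(x+e_j,k)⁻¹ · h(x+e_j)⁻¹ · U(x,j)⁻¹` —
the two plane links of the plaquette are translated by the elements at the two ENDPOINTS of its transverse link. [cite: tHooft1979] -/
theorem plaquetteHolonomy_siteTwist_fst (k : Fin 3) (h : Site 3 L → G) (U : GaugeConfig 3 L G) (x : Site 3 L) {j : Fin 3} (hkj : k ≠ j)
    (hx : x k = 0) :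
    plaquetteHolonomy (siteTwist k h U) x k j =
      h x * (U (x, k) * U (x.shift k, j) * (U (x.shift j, k))⁻¹) * (h (x.shift j))⁻¹ * (U (x, j))⁻¹ := by
  have hsh : (x.shift j) k = 0 := by
    have : (x.shift j) k = x k := by simp [Site.shift, Pi.single_eq_of_ne hkj]
    rw [this, hx]
  have hjk : ¬ (j = k) := fun h' => hkj h'.symm
  unfold plaquetteHolonomy
  simp only [siteTwist, hx, hsh, hjk, and_true, if_true, false_and, if_false, mul_inv_rev]
  simp only [mul_assoc]

omit ρ in
/-- **Second direction on the plane** (`i ≠ k`, `x_k = 0`): `(siteTwist_k^h U)_{x;i,k} = U(x,i) · h(x+e_i) · U(x+e_i,k) U(x+e_k,i)⁻¹ U(x,k)⁻¹ · h(x)⁻¹`.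
[cite: tHooft1979] -/
theorem plaquetteHolonomy_siteTwist_snd (k : Fin 3) (h : Site 3 L → G) (U : GaugeConfig 3 L G) (x : Site 3 L) {i : Fin 3} (hik : i ≠ k)
    (hx : x k = 0) :
    plaquetteHolonomy (siteTwist k h U) x i k =
      U (x, i) * h (x.shift i) * (U (x.shift i, k) * (U (x.shift k, i))⁻¹ * (U (x, k))⁻¹) * (h x)⁻¹ := by
  have hsh : (x.shift i) k = 0 := by
    have : (x.shift i) k = x k := by simp [Site.shift, Pi.single_eq_of_ne (Ne.symm hik)]
    rw [this, hx]
  unfold plaquetteHolonomy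
  simp only [siteTwist, hx, hsh, hik, and_true, if_true, false_and, if_false, mul_inv_rev]
  simp only [mul_assoc]

/-- The trace of the second formula: `tr ρ((siteTwist_k^h U)_{x;i,k}) = tr ρ((h(x)⁻¹ U(x,i) h(x+e_i)) · U(x+e_i,k) U(x+e_k,i)⁻¹ U(x,k)⁻¹)` — the first link
is replaced by its COVARIANT TRANSPORT MISMATCH `h(x)⁻¹ U(x,i) h(x+e_i)`. [folklore] -/
theorem trace_plaquetteHolonomy_siteTwist_snd (k : Fin 3) (h : Site 3 L → G) (U : GaugeConfig 3 L G) (x : Site 3 L) {i : Fin 3} (hik : i ≠ k)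
    (hx : x k = 0) :
    (ρ (plaquetteHolonomy (siteTwist k h U) x i k)).trace =
      (ρ ((h x)⁻¹ * U (x, i) * h (x.shift i) * (U (x.shift i, k) * (U (x.shift k, i))⁻¹ * (U (x, k))⁻¹))).trace := by
  rw [plaquetteHolonomy_siteTwist_snd k h U x hik hx]
  have e1 : U (x, i) * h (x.shift i) * (U (x.shift i, k) * (U (x.shift k, i))⁻¹ * (U (x, k))⁻¹) * (h x)⁻¹ =
      h x * ((h x)⁻¹ * U (x, i) * h (x.shift i) * (U (x.shift i, k) * (U (x.shift k, i))⁻¹ * (U (x, k))⁻¹)) * (h x)⁻¹ := by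
    simp only [← mul_assoc, mul_inv_cancel, one_mul]
  rw [e1, map_mul, map_mul, Matrix.trace_mul_cycle, ← map_mul, inv_mul_cancel, map_one, one_mul]

/-- The trace of the first formula: `tr ρ((siteTwist_k^h U)_{x;k,j}) = tr ρ(U(x,k) U(x+e_k,j) U(x+e_j,k)⁻¹ · (h(x+e_j)⁻¹ U(x,j)⁻¹ h(x)))` — the last
(inverse transverse) link is replaced by its transport mismatch. [folklore] -/
theorem trace_plaquetteHolonomy_siteTwist_fst (k : Fin 3) (h : Site 3 L → G) (U : GaugeConfig 3 L G) (x : Site 3 L) {j : Fin 3} (hkj : k ≠ j)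
    (hx : x k = 0) :
    (ρ (plaquetteHolonomy (siteTwist k h U) x k j)).trace =
      (ρ (U (x, k) * U (x.shift k, j) * (U (x.shift j, k))⁻¹ * ((h (x.shift j))⁻¹ * (U (x, j))⁻¹ * h x))).trace := by
  rw [plaquetteHolonomy_siteTwist_fst k h U x hkj hx]
  have e1 : h x * (U (x, k) * U (x.shift k, j) * (U (x.shift j, k))⁻¹) * (h (x.shift j))⁻¹ * (U (x, j))⁻¹ =
      h x * (U (x, k) * U (x.shift k, j) * (U (x.shift j, k))⁻¹ * ((h (x.shift j))⁻¹ * (U (x, j))⁻¹ * h x)) * (h x)⁻¹ := by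
    simp only [← mul_assoc]; rw [mul_assoc _ (h x) (h x)⁻¹, mul_inv_cancel, mul_one]
  rw [e1, map_mul, map_mul, Matrix.trace_mul_cycle, ← map_mul, inv_mul_cancel, map_one, one_mul]

/-- ★ **The action change under a site-dependent sheet translate is a sum of plane defects**:
`S(siteTwist_k^h U) − S(U) = Σ_{p : x_k = 0 ∧ (i = k ∨ j = k)} (Re tr ρ(U_p) − Re tr ρ((siteTwist_k^h U)_p))`. [cite: tHooft1979] [cite: Wilson1974] -/
theorem wilsonAction_siteTwist_sub [NeZero L] (k : Fin 3) (h : Site 3 L → G) (U : GaugeConfig 3 L G) :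
    wilsonAction ρ (siteTwist k h U) - wilsonAction ρ U =
      ∑ p ∈ Finset.univ.filter (fun p : Plaquette 3 L => p.1 k = 0 ∧ (p.2.1.1 = k ∨ p.2.1.2 = k)),
        ((ρ (plaquetteHolonomy U p.1 p.2.1.1 p.2.1.2)).trace.re - (ρ (plaquetteHolonomy (siteTwist k h U) p.1 p.2.1.1 p.2.1.2)).trace.re) := by
  unfold wilsonAction
  rw [← Finset.sum_sub_distrib]
  have hterm : ∀ p : Plaquette 3 L,
      ((N : ℝ) - (ρ (plaquetteHolonomy (siteTwist k h U) p.1 p.2.1.1 p.2.1.2)).trace.re) -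
        ((N : ℝ) - (ρ (plaquetteHolonomy U p.1 p.2.1.1 p.2.1.2)).trace.re) =
      (ρ (plaquetteHolonomy U p.1 p.2.1.1 p.2.1.2)).trace.re - (ρ (plaquetteHolonomy (siteTwist k h U) p.1 p.2.1.1 p.2.1.2)).trace.re :=
    fun p => by ring
  simp only [hterm]
  symm
  refine Finset.sum_filter_of_ne fun p _ hp => ?_
  by_contra hnot
  apply hp
  have hij : p.2.1.1 ≠ p.2.1.2 := ne_of_lt p.2.2
  have hsame : plaquetteHolonomy (siteTwist k h U) p.1 p.2.1.1 p.2.1.2 = plaquetteHolonomy U p.1 p.2.1.1 p.2.1.2 := by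
    by_cases hx : p.1 k = 0
    · have hne : ¬ (p.2.1.1 = k ∨ p.2.1.2 = k) := fun h' => hnot ⟨hx, h'⟩
      exact plaquetteHolonomy_siteTwist_of_ne_of_ne k h U p.1 (fun h1 => hne (Or.inl h1)) (fun h2 => hne (Or.inr h2))
    · exact plaquetteHolonomy_siteTwist_of_apply_ne_zero k h U p.1 hij hx
  rw [hsame, sub_self]

variable (hρu : ∀ g, ρ g ∈ Matrix.unitaryGroup (Fin N) ℂ)

include hρu in
/-- ★ **Second plane defect ≤ one transport mismatch**: for `i ≠ k`, `x_k = 0` and a unitary representation,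
`|Re tr ρ(U_{x;i,k}) − Re tr ρ((siteTwist_k^h U)_{x;i,k})| ≤ √N · ‖ρ(U(x,i)) ρ(h(x+e_i)) − ρ(h x) ρ(U(x,i))‖_F` — the defect vanishes exactly when `h` is
covariantly transported along the transverse link `U(x,i)`. [cite: tHooft1979] [cite: Luscher1983, §2] -/
theorem abs_re_trace_plaquette_siteTwist_snd_sub_le [NeZero L] (k : Fin 3) (h : Site 3 L → G) (U : GaugeConfig 3 L G) (x : Site 3 L) {i : Fin 3}
    (hik : i ≠ k) (hx : x k = 0) :
    |(ρ (plaquetteHolonomy U x i k)).trace.re - (ρ (plaquetteHolonomy (siteTwist k h U) x i k)).trace.re| ≤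
      Real.sqrt N * frobNorm (ρ (U (x, i)) * ρ (h (x.shift i)) - ρ (h x) * ρ (U (x, i))) := by
  have hcs : ∀ X Y : Matrix (Fin N) (Fin N) ℂ, |X.trace.re - Y.trace.re| ≤ Real.sqrt N * frobNorm (X - Y) := fun X Y => by
    have h1 : frobNorm (1 : Matrix (Fin N) (Fin N) ℂ) = Real.sqrt N := by
      rw [← Real.sqrt_sq (frobNorm_nonneg _), frobNorm_sq_of_mem_unitaryGroup (Submonoid.one_mem _), Fintype.card_fin]
    have := abs_re_trace_mul_le (1 : Matrix (Fin N) (Fin N) ℂ) (X - Y)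
    rwa [one_mul, h1, Matrix.trace_sub, Complex.sub_re] at this
  rw [trace_plaquetteHolonomy_siteTwist_snd ρ k h U x hik hx]
  set X : G := U (x.shift i, k) * (U (x.shift k, i))⁻¹ * (U (x, k))⁻¹ with hX
  have hhol : plaquetteHolonomy U x i k = U (x, i) * X := by
    simp only [plaquetteHolonomy, hX, mul_assoc]
  rw [hhol, map_mul, map_mul ρ _ X]
  have hc1 : (ρ (U (x, i)) * ρ X).trace = (ρ X * ρ (U (x, i))).trace := Matrix.trace_mul_comm _ _
  have hc2 : (ρ ((h x)⁻¹ * U (x, i) * h (x.shift i)) * ρ X).trace = (ρ X * ρ ((h x)⁻¹ * U (x, i) * h (x.shift i))).trace :=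
    Matrix.trace_mul_comm _ _
  rw [hc1, hc2]
  refine (hcs _ _).trans ?_
  refine mul_le_mul_of_nonneg_left ?_ (Real.sqrt_nonneg _)
  rw [← Matrix.mul_sub, frobNorm_unitary_mul (hρu X), frobNorm_sub_comm]
  -- `‖ρ(h⁻¹ Y h') − ρ Y‖_F = ‖ρ Y ρ h' − ρ h ρ Y‖_F` (left-multiply by the unitary `ρ h`)
  have e1 : ρ (h x) * (ρ ((h x)⁻¹ * U (x, i) * h (x.shift i)) - ρ (U (x, i))) = ρ (U (x, i)) * ρ (h (x.shift i)) - ρ (h x) * ρ (U (x, i)) := by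
    rw [Matrix.mul_sub, map_mul, map_mul, ← Matrix.mul_assoc, ← Matrix.mul_assoc, ← map_mul, mul_inv_cancel, map_one, Matrix.one_mul]
  rw [← frobNorm_unitary_mul (hρu (h x)), e1]

end Plaquette

/-! ## §4 `SU(2)`: holonomies through the origin -/

section Holonomy

variable {L : ℕ}

/-- `P_n(siteTwist₀^h U) = h(0) · P_n(U)` for `1 ≤ n ≤ L`: exactly the link at the origin of the `x`-axis lies on the plane. [cite: tHooft1979] -/
theorem polyXAux_siteTwist_zero (h : Site 3 L → SU2) (U : GaugeConfig 3 L SU2) {n : ℕ} (hn1 : 1 ≤ n) (hnL : n ≤ L) :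
    FlatSheet.polyXAux (siteTwist 0 h U) n = h 0 * FlatSheet.polyXAux U n := by
  induction n with
  | zero => exact absurd hn1 (by norm_num)
  | succ n ih =>
    rw [FlatSheet.polyXAux_succ, FlatSheet.polyXAux_succ]
    rcases Nat.eq_zero_or_pos n with rfl | hn
    · simp only [FlatSheet.polyXAux_zero, one_mul, siteTwist, FlatSheet.lineEdge, Nat.cast_zero, Pi.single_zero, Pi.zero_apply, and_self,
        if_true]
    · rw [ih hn (Nat.le_of_succ_le hnL), mul_assoc]
      congr 1
      simp only [siteTwist]
      rw [if_neg]
      rintro ⟨-, h'⟩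
      exact FlatSheet.lineEdge_fst_apply_zero_ne hn (Nat.lt_of_succ_le hnL) h'

/-- ★ `polyX (siteTwist₀^h U) = h(0) · polyX U` and hence `polDist (siteTwist 0 h U) = vacDist (h 0 · polyX U)`. [cite: Luscher1983, §2] -/
theorem polyX_siteTwist_zero [NeZero L] (h : Site 3 L → SU2) (U : GaugeConfig 3 L SU2) :
    FlatSheet.polyX (siteTwist 0 h U) = h 0 * FlatSheet.polyX U :=
  polyXAux_siteTwist_zero h U (Nat.one_le_iff_ne_zero.2 (NeZero.ne L)) le_rfl

/-- The core goes to the annulus of radius `vacDist (h 0)`: `|polDist (siteTwist 0 h U) − vacDist (h 0)| ≤ polDist U`. [cite: Luscher1983, §2] -/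
theorem abs_polDist_siteTwist_zero_sub_le [NeZero L] (h : Site 3 L → SU2) (U : GaugeConfig 3 L SU2) :
    |FlatSheet.polDist (siteTwist 0 h U) - vacDist (h 0)| ≤ FlatSheet.polDist U := by
  unfold FlatSheet.polDist
  rw [polyX_siteTwist_zero]
  exact abs_vacDist_mul_sub_le (h 0) (FlatSheet.polyX U)

/-- `P_π (siteTwist_k^h U) = siteTwist_{π k}^{h ∘ π⁻¹} (P_π U)`: an axis permutation conjugates the site-dependent translate. [folklore] -/
theorem configPerm_siteTwist {G : Type*} [Group G] [MeasurableSpace G] (π : Equiv.Perm (Fin 3)) (k : Fin 3) (h : Site 3 L → G)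
    (U : GaugeConfig 3 L G) :
    configPerm π (siteTwist k h U) = siteTwist (π k) (fun x => h (sitePerm π.symm x)) (configPerm π U) := by
  funext e
  simp only [configPerm_apply, siteTwist, sitePerm_apply, Equiv.symm_symm]
  have hiff : π.symm e.2 = k ↔ e.2 = π k := by
    constructor
    · intro h'; rw [← h', Equiv.apply_symm_apply]
    · intro h'; rw [h', Equiv.symm_apply_apply]
  by_cases hc : e.2 = π k ∧ e.1 (π k) = 0
  · rw [if_pos hc, if_pos (by exact ⟨hiff.mpr hc.1, hc.2⟩)]
  · rw [if_neg hc, if_neg (by exact fun h' => hc ⟨hiff.mp h'.1, h'.2⟩)]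

/-- The `y`- and `z`-holonomies through the origin do not see the `x`-sheet site-translate. [cite: Luscher1983, §2] -/
theorem polDist_configPerm_swap_siteTwist_zero {j : Fin 3} (hj : j ≠ 0) (h : Site 3 L → SU2) (U : GaugeConfig 3 L SU2) :
    FlatSheet.polDist (configPerm (Equiv.swap (0 : Fin 3) j) (siteTwist 0 h U)) =
      FlatSheet.polDist (configPerm (Equiv.swap (0 : Fin 3) j) U) := by
  rw [configPerm_siteTwist, Equiv.swap_apply_left]
  unfold FlatSheet.polDist
  congr 1
  refine FlatSheet.polyXAux_congr (fun n => ?_) L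
  simp only [siteTwist, FlatSheet.lineEdge]
  rw [if_neg]
  rintro ⟨h0, -⟩
  exact hj h0.symm

end Holonomy

end Summit.QuantumFields.YangMills.Theorems.FemtoTransferGap

end
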